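import Literature.AlgebraicGeometry.ComplexMultiplication.CyclotomicFermatCMTypesLevelPullback
import Literature.AlgebraicGeometry.ComplexMultiplication.CyclotomicFermatCMTypesTwoPowerLevelFurthermore
import Literature.AlgebraicGeometry.ComplexMultiplication.CyclotomicFermatCMTypesPrimePowerIsogenies
import Literature.AlgebraicGeometry.ComplexMultiplication.SimpleCMAbelianVarietyIsogenyClasses
import Literature.AlgebraicGeometry.ComplexMultiplication.InducedCMTypeNotSimple
import HarnessLib

/-!
# Koblitz–Rohrlich §1 ON ABELIAN VARIETIES: the level of a triple — `A_{(dr, ds, dt)}` over `ℚ(ζ_{dM})` is isogenous to the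
# `φ(dM)/φ(M)`-th power of `L_{r,s,t}` over `ℚ(ζ_M)` (dimension `φ(M)/2`); THEOREM 4 «Furthermore» (a)ₘ `∼` e)ₘ₊₁ `×` e)ₘ₊₁) as printed

Layer `Literature/AlgebraicGeometry/ComplexMultiplication`; §§1–2 in namespace `…ComplexMultiplication.CyclotomicCMType` (any CM residue
set), §§3–5 in `…ComplexMultiplication.CyclotomicFermatCMType`.  Sequel of `CyclotomicFermatCMTypesLevelPullback` (gen 36: the change of
level ON RESIDUE SETS, `x ∈ H_{(da,db,dc)} ⊂ (ℤ/dM)ˣ ↔ x̄ ∈ H_{(a,b,c)} ⊂ (ℤ/M)ˣ`, whose honest column reads «K–R phrase the change of level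
through lattices `L_{r,s} ⊂ ℂ^{φ(M)/2}` …; typed is only the residue-set statement») and of the Theorem-4 files
(`…TwoPowerLevelFurthermore` etc.: the «Furthermore» clause typed as an EQUALITY of residue sets `H_{a)₀} = H_{e)₁}` at the full level,
honest columns of gens 36–38: «the "H equal" rendering of the Furthermore pairs, not K–R's PRODUCT statement; dimension bookkeeping
not typed»).  THIS FILE carries both to ABELIAN VARIETIES.  THEOREMS ONLY (no definition, no named fact, no `sorry`, no kernel `decide`).

THE SOURCE.  N. Koblitz, D. Rohrlich, *Simple factors in the Jacobian of a Fermat curve*, Canad. J. Math. **30** (1978) 1183–1205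
(held `paper:koblitz1978-simple-factors-jacobian-fermat-curve`, pp. 1183–1186 read first-hand).  §1 p. 1183: "Given a pair of integers
`(r, s)` … let `M` be the integer defined by `N/M = g.c.d.(N, r, s)`. … let `H_{r,s}` be the subset of `(ℤ/Mℤ)*` of all elements `h` such
that `⟨hr⟩ + ⟨hs⟩ ≤ N − 1`.  Then `H_{r,s}` is a set of coset representatives for `{−1, 1}` in `(ℤ/Mℤ)*`.  Making the usual identification
of `(ℤ/Mℤ)*` with `Gal(ℚ(e^{2πi/M})/ℚ)`, `h ↦ σ_h`, where `σ_h(e^{2πi/M}) = e^{2πih/M}`, we define `L_{r,s}` as the lattice in `ℂ^{φ(M)/2}`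
consisting of all vectors `(σ_h(z))_{h ∈ H_{r,s}}` where `z` runs through the integers of `ℚ(e^{2πi/M})`"; p. 1184: "`L_{r,s}` is simple if
and only if `W_{r,s} = {1}`. Suppose `W_{r,s} ≠ {1}`. Then `L_{r,s}` is isogenous to a product of `|W_{r,s}|` isomorphic simple factors …
These factors have complex multiplication by an order of the fixed field of `W_{r,s}` and CM-type equal to `H_{r,s}/W_{r,s}`";
THEOREM 4 (p. 1186): "Suppose `N = 2ⁿ`. Then the only isogenies apart from the obvious ones are between pairs of lattices corresponding to
the triples a) `(2ᵐ, 2ⁿ⁻¹ − 2ᵐ⁺¹, 2ⁿ⁻¹ + 2ᵐ)` and … e) `(2ᵐ, 2ⁿ⁻¹, 2ⁿ⁻¹ − 2ᵐ)` and `(2ᵐ, 2ᵐ, 2ⁿ − 2ᵐ⁺¹)` for `0 ≤ m ≤ n − 2`.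
Furthermore, a lattice of type a)ₘ is isogenous to the product of two lattices of type e)ₘ₊₁."  G. Shimura, *Abelian Varieties with
Complex Multiplication and Modular Functions* (1998), §6.2 THEOREM 3 with its proof (pp. 42–44: the abelian varieties of a type INDUCED
from `(K; Φ)` along `K ⊂ F` are isogenous to `B^{[F:K]}`, `B` of type `(K; Φ)`; tree THEOREM `Shimura1998_Thm3_isogenousPower_holds` on
realisations read on `H¹`), §8.2 Prop. 26 (simple `⟺` primitive; tree `isSimple_iff_isPrimitive`, `isPrimitive_iff_hasTrivialStabilizer`).

THE DICTIONARY.  The siblings read EVERY triple `τ = (r, s, t)` modulo `N` at the full level: "an abelian variety of type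
`(ℚ(ζ_N); Φ_{H_τ})`" (`IsCMTypeRealisation (cmTypeOfResidues (fermatCMType N r s t) _) A ι θ`), of dimension `φ(N)/2`.  For a triple of
`g.c.d.` `d = N/M` this is NOT Koblitz–Rohrlich's `L_τ` (dimension `φ(M)/2`, complex multiplication by `ℚ(ζ_M)`), but — this file — a
variety isogenous to the POWER `L_τ^{φ(N)/φ(M)}`; the precise link is that `Φ_{H_{(da,db,dc)}}` is the CM type of `ℚ(ζ_N)` INDUCED from
the CM type `Φ_{H_{(a,b,c)}}` of the subfield `ℚ(ζ_M) = ℚ(ζ_N^d)`.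

## What is proved

* §1 (`CyclotomicCMType`, any `M`, `d` with `dM ≠ 0`, `K = ℚ(ζ_M)`, `L = ℚ(ζ_{dM})` arbitrary models): `isPrimitiveRoot_zetaOf_pow` (`ζ_{dM}^d` is a
  primitive `M`-th root of unity); **`exists_ringHom_apply_zetaOf_eq_pow`** (an embedding `k : K → L` with `k(ζ_M) = ζ_{dM}^d`);
  **`expOf_comp_eq_castHom`** (for such `k` the exponent of `τ ∘ k` is the reduction modulo `M` of the exponent of `τ`: restriction of
  embeddings `=` reduction `(ℤ/dM)ˣ → (ℤ/M)ˣ`); `coprime_castHom_expOf`.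
* §2 **`inducedCMType_cmTypeOfResidues_eq`**: for a CM residue set `S ⊂ (ℤ/M)ˣ` and its pull-back `S′ ⊂ (ℤ/dM)ˣ` under reduction, the CM
  type `Φ_{S′}` of `L` is the type INDUCED from `Φ_S` along `k` (`inducedCMType k Φ_S = Φ_{S′}`).
* §3 (Fermat triples, `a, b, c : ℕ`): `isCMResidueSet_fermatCMType_level_mul` (`H_{(da,db,dc)}` mod `dM` is a CM residue set when
  `H_{(a,b,c)}` mod `M` is); **`inducedCMType_fermatCMType_level_mul`**: `Φ_{H_{(da,db,dc)}} = (Φ_{H_{(a,b,c)}})^L` — THE LEVEL OF A TRIPLE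
  AS AN INDUCED TYPE (from the sibling's `mem_fermatCMType_level_mul_iff`).
* §4 ON ABELIAN VARIETIES (`K`, `L` CM fields, i.e. `M ≥ 3`): **`exists_isIsogeny_power_level_mul_raw`** ∕ **`exists_isIsogeny_power_level_mul`**
  — for ANY abelian variety `(A, ι, θ)` realising `Φ_{H_{(da,db,dc)}}` of `ℚ(ζ_{dM})`: an embedding `k` (`ζ_M ↦ ζ_{dM}^d`), an abelian variety
  `(B, ι_B, θ_B)` realising Koblitz–Rohrlich's `(ℚ(ζ_M); Φ_{H_{(a,b,c)}})` with `dim B = φ(M)/2` ("the lattice in `ℂ^{φ(M)/2}`"),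
  `φ(M) ∣ φ(dM)`, `dim A = (φ(dM)/φ(M))·dim B`, a product `P = B^{φ(dM)/φ(M)}` (limit fan) and an `𝓞_{ℚ(ζ_M)}`-equivariant ISOGENY
  `A → B^{φ(dM)/φ(M)}`; **`isSimple_iff_hasTrivialStabilizer_fermatCMType`** («`L_{r,s}` is simple iff `W_{r,s} = {1}`» for the
  level-`M` variety, any admissible residues); **`exists_isIsogeny_power_simple_level_mul`** (if `W_{(a,b,c)} = {1}` mod `M` the factor `B`
  is SIMPLE: the simple factors of `A_{(da,db,dc)}` have dimension `φ(M)/2`, multiplicity `φ(dM)/φ(M)`, complex multiplication by `ℚ(ζ_M)`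
  and type `H_{(a,b,c)}` — K–R's "`|W|` isomorphic simple factors … fixed field of `W` … CM-type `H/W`" in the case where `W` is the kernel
  of `(ℤ/N)ˣ → (ℤ/M)ˣ`); **`not_isSimple_level_mul`** (`φ(M) < φ(dM)` ⟹ the full-level variety is NOT simple — Shimura §6.2 Thm. 3, last
  clause, tree `not_isSimple_of_isCMTypeRealisation_inducedCMType`).
* §5 THEOREM 4 «FURTHERMORE» AS PRINTED, ON ABELIAN VARIETIES (`N = 2·2ᵏ`, `k ≥ 2`, i.e. K–R's `n = k + 1 ≥ 3`, `m = 0`):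
  **`exists_isIsogeny_prod_two_twoPow_furthermore`** — every abelian variety realising the a)₀ type `Φ_{H_{(1, 2ᵏ − 2, 2ᵏ + 1)}}` of `ℚ(ζ_N)`
  (dimension `2ᵏ⁻¹`) admits an `𝓞_{ℚ(ζ_{2ᵏ})}`-equivariant ISOGENY onto a product `B × B` (limit fan on `Fin 2`), `B` realising the e)₀ type
  `(ℚ(ζ_{2ᵏ}); Φ_{H_{(1, 2ᵏ⁻¹, 2ᵏ⁻¹ − 1)}})` — the type-e)₁ lattice of level `N` at its own level — with `2 dim B = 2ᵏ⁻¹`, `dim A = 2 dim B`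
  (sibling `fermatCMType_twoPow_furthermore_eq` + §4 with `d = 2`, `φ(2ᵏ⁺¹)/φ(2ᵏ) = 2`); `cmTypeOfResidues_twoPow_e_eq` (both e)₀ triples give
  the same type, sibling `fermatCMType_twoPow_e_eq`); `exists_realisation_isIsogeny_prod_two_twoPow_furthermore` (NON-VACUITY: the residue-set
  hypotheses hold and such `A`, `B`, `A → B × B` exist).

## Honest column / NOT here

* "Isogenous to `B^h`" is, as in `CyclotomicCMTypeIsogenyClasses` ∕ `SimpleCMAbelianVarietyIsogenyClasses` (gen 14) and
  `…RemarkTwoEllipticFactors` (gen 36), an isogeny `A → P` onto a categorical product `P` (`Fan.mk P π` a limit over `Fin h`); `B` is SOME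
  realisation of `(ℚ(ζ_M); Φ_{H_{(a,b,c)}})` (any two are isogenous, Shimura §6.1 Cor.; the tree's `Shimura1998_Thm3_isogenousPower` leaves the
  factor existential) — K–R's `L_{r,s,t}` is the realisation `ℂ^{φ(M)/2}/(σ_h(𝓞))`, which is not singled out here.
* The field `ℚ(ζ_M)` is any model `K` (`IsCyclotomicExtension {M} ℚ K`) with the embedding normalised by `k(ζ_M) = ζ_{dM}^d` on Mathlib's
  chosen generators (`IsCyclotomicExtension.zeta`); for an un-normalised embedding the induced type is a unit translate `Φ_{H_{u·(a,b,c)}}`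
  (an "obvious equality"), not spelled out.  `M ≥ 3` enters as `IsCMField K`.
* K–R's general case of p. 1184 (`W ≠ {1}`: simple factors with CM by the fixed field of `W`, type `H/W`) is the tree's ABSTRACT
  `exists_isIsogeny_power_simple_cyclotomic` (gen 14); here only the level part of `W` (the kernel of reduction) is made explicit — when
  `W_{(a,b,c)} ≠ {1}` modulo `M` the factor `B` of §4 is itself a power (not combined here).
* THEOREM 4 «Furthermore» for `m ≥ 1`: in K–R's convention the type-a)ₘ lattice at `N = 2ⁿ` IS the type-a)₀ lattice at `2^{n−m}` (same `M`,
  same `H`), so §5 at `k + 1 = n − m` is the printed statement; the full-level variety of the a)ₘ triple is, by §4, isogenous to the `2ᵐ`-th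
  power of the a)₀ variety — the composite "`∼ (B × B)^{2ᵐ}`" is not assembled.  `B` (type e)₀, level `2ᵏ`, `k ≥ 3`) is itself NOT simple
  (`2ᵏ⁻¹ − 1 ∈ W`, sibling `fermatCMType_twoPow_e_stabiliser`) — K–R do not claim it is; not restated.
* Nothing here uses lattices or Riemann forms: the road is the `H¹`-realisation road of the tree (`Shimura1998_Thm3_isogenousPower_holds`,
  discharged from Riemann's theorem in `ShimuraIsogenousPowerHolds`); the LATTICE road (`CMAbelianVarietyIsogenousPower.isIsogenous_powSucc`,
  for `A^an = ℂ^Φ/D(𝔞)`) is not used and nothing is restated from it.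

## References

* [KoblitzRohrlich1978] N. Koblitz, D. Rohrlich, Canad. J. Math. 30 (1978) 1183–1205: §1 (pp. 1183–1184), Theorem 4 (p. 1186).
* [Shimura1998] G. Shimura, *Abelian Varieties with Complex Multiplication and Modular Functions*, Princeton (1998): §6.2 Theorem 3
  (pp. 41–44), §6.1 Corollary of Theorem 2 (p. 41), §8.2 Prop. 26 (through `ShimuraIsogenousPowerHolds`, `SimpleIffPrimitiveCMType`,
  `InducedCMTypeNotSimple`, `CyclotomicCMTypeResidueSets`).
* [Washington1997] L. C. Washington, *Introduction to Cyclotomic Fields*, Thm. 2.5 (`Gal(ℚ(ζ_N)/ℚ) ≅ (ℤ/N)ˣ`; Mathlib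
  `IsPrimitiveRoot.embeddingsEquivPrimitiveRoots`).
* [MilneCM2006] J. S. Milne, *Complex Multiplication* (course notes), Ch. I §3, proof of Prop. 3.13 («`A` will be isogenous to
  `A_{Φ₀}^{[E:E₀]}`»; through `SimpleCMAbelianVarietyIsogenyClasses`).

## Provenance

Cell `pub-hodgecm2` (COR-CM), literature seat `lit-deligne-3` gen 39 (claim KR78-LEVEL-VARIETIES; count-neutral, own lane).
-/

noncomputable section

open NumberField Polynomial

namespace Literature.AlgebraicGeometry.ComplexMultiplication

open CategoryTheory CategoryTheory.Limits
open Literature.AlgebraicGeometry.Motives (CMType AbelianVariety)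
open Literature.AlgebraicGeometry.Motives.AbelianVariety
open Literature.AlgebraicGeometry.HodgeTheory (complexBetti fermatCMType)
open Literature.NumberTheory.ComplexMultiplication
open Literature.AlgebraicGeometry.Pohlmann1968 Literature.AlgebraicGeometry.Pohlmann1968.Cyclotomic
open CyclotomicCMTypeResidueSets (unitResidues IsCMResidueSet residueSet residueSet_cmTypeOfResidues HasTrivialStabilizer
  coprime_iff_mem_unitResidues isPrimitive_iff_hasTrivialStabilizer)

/-! ## §1 The subfield `ℚ(ζ_M) ⊂ ℚ(ζ_{dM})`: the embedding `ζ_M ↦ ζ_{dM}^d` and the exponents of the complex embeddings -/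

namespace CyclotomicCMType

section Helpers

/-- `0 < d` when `dM ≠ 0`. [folklore] -/
private theorem pos_of_neZero_level (M d : ℕ) [NeZero (d * M)] : 0 < d :=
  Nat.pos_of_ne_zero fun h => NeZero.ne (d * M) (by rw [h, zero_mul])

/-- `e^{2πi/n}` is a primitive `n`-th root of unity, so `(e^{2πi/n})^n = 1`. [folklore] -/
private theorem rootζ_pow_level (n : ℕ) [NeZero n] : rootζ n ^ n = 1 := by
  have h : IsPrimitiveRoot (rootζ n) n := by simpa [rootζ] using Complex.isPrimitiveRoot_exp n (NeZero.ne n)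
  exact h.pow_eq_one

/-- `(e^{2πi/(dM)})^d = e^{2πi/M}`. [folklore] -/
private theorem rootζ_level_mul_pow (M d : ℕ) [NeZero M] [NeZero (d * M)] : rootζ (d * M) ^ d = rootζ M := by
  rw [rootζ, rootζ, ← Complex.exp_nat_mul]
  congr 1
  have hd : (d : ℂ) ≠ 0 := Nat.cast_ne_zero.2 (pos_of_neZero_level M d).ne'
  have hM : (M : ℂ) ≠ 0 := Nat.cast_ne_zero.2 (NeZero.ne M)
  push_cast
  field_simp

/-- A residue is a unit iff its `val` is prime to the modulus. [folklore] -/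
private theorem isUnit_iff_val_coprime_level {m : ℕ} [NeZero m] (x : ZMod m) : IsUnit x ↔ x.val.Coprime m := by
  conv_lhs => rw [← ZMod.natCast_zmod_val x]
  exact ZMod.isUnit_iff_coprime x.val m

/-- Units are closed under negation, on `val`. [folklore] -/
private theorem coprime_val_neg_level {m : ℕ} [NeZero m] {x : ZMod m} (hx : x.val.Coprime m) : (-x).val.Coprime m :=
  (isUnit_iff_val_coprime_level _).1 ((isUnit_iff_val_coprime_level x).2 hx).neg

/-- The reduction of a unit modulo `dM` is a unit modulo `M`, on `val`. [folklore] -/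
private theorem coprime_val_castHom_level {M d : ℕ} [NeZero (d * M)] {x : ZMod (d * M)} (hx : x.val.Coprime (d * M)) :
    (ZMod.castHom (dvd_mul_left M d) (ZMod M) x).val.Coprime M := by
  rw [ZMod.castHom_apply, ZMod.cast_eq_val, ZMod.val_natCast]
  have h : x.val.Coprime M := Nat.Coprime.coprime_mul_left_right hx
  unfold Nat.Coprime at h ⊢
  rw [← Nat.gcd_rec, Nat.gcd_comm]
  exact h

end Helpers

section Level

variable {M d : ℕ} [NeZero M] [NeZero (d * M)]
  {K : Type} [Field K] [NumberField K] [IsCyclotomicExtension {M} ℚ K]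
  {L : Type} [Field L] [NumberField L] [IsCyclotomicExtension {d * M} ℚ L]

omit [NeZero M] in
/-- `ζ_{dM}^d` is a primitive `M`-th root of unity in `ℚ(ζ_{dM})` (`e^{2πi/M} = (e^{2πi/N})^{N/M}`).
[cite: Washington1997, Thm. 2.5] [cite: KoblitzRohrlich1978, §1 (p. 1183)] -/
theorem isPrimitiveRoot_zetaOf_pow : IsPrimitiveRoot (zetaOf (d * M) L ^ d) M :=
  (IsCyclotomicExtension.zeta_spec (d * M) ℚ L).pow (Nat.pos_of_ne_zero (NeZero.ne _)) rfl

variable (K L) in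
/-- **The inclusion `ℚ(ζ_M) ⊂ ℚ(ζ_{dM})` normalised on the generators**: there is a field embedding `k : ℚ(ζ_M) → ℚ(ζ_{dM})` with
`k(ζ_M) = ζ_{dM}^d` ("making the usual identification of `(ℤ/Mℤ)*` with `Gal(ℚ(e^{2πi/M})/ℚ)`", with `e^{2πi/M} = (e^{2πi/N})^{N/M}`).
[cite: KoblitzRohrlich1978, §1 (p. 1183)] [cite: Washington1997, Thm. 2.5] -/
theorem exists_ringHom_apply_zetaOf_eq_pow : ∃ k : K →+* L, k (zetaOf M K) = zetaOf (d * M) L ^ d := by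
  have hirr : Irreducible (cyclotomic M ℚ) := cyclotomic.irreducible_rat (Nat.pos_of_ne_zero (NeZero.ne M))
  have hmem : zetaOf (d * M) L ^ d ∈ primitiveRoots M L :=
    (mem_primitiveRoots (Nat.pos_of_ne_zero (NeZero.ne M))).2 isPrimitiveRoot_zetaOf_pow
  let φ : K →ₐ[ℚ] L :=
    ((IsCyclotomicExtension.zeta_spec M ℚ K).embeddingsEquivPrimitiveRoots L hirr).symm ⟨_, hmem⟩
  refine ⟨φ.toRingHom, ?_⟩
  have h := (IsCyclotomicExtension.zeta_spec M ℚ K).embeddingsEquivPrimitiveRoots_apply_coe L hirr φ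
  simp only [φ, Equiv.apply_symm_apply] at h
  exact h.symm

/-- **Restriction of embeddings read on exponents**: if `k(ζ_M) = ζ_{dM}^d` then for every complex embedding `τ` of `ℚ(ζ_{dM})` the
exponent of `τ ∘ k` (on `ζ_M`) is the reduction modulo `M` of the exponent of `τ` (on `ζ_{dM}`): `e_M(τ|_{ℚ(ζ_M)}) = e_{dM}(τ) mod M` — the
restriction `Gal(ℚ(ζ_N)/ℚ) = (ℤ/N)ˣ → (ℤ/M)ˣ = Gal(ℚ(ζ_M)/ℚ)` is reduction. [cite: Washington1997, Thm. 2.5] [cite: KoblitzRohrlich1978, §1 (pp. 1183–1184)] -/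
theorem expOf_comp_eq_castHom {k : K →+* L} (hk : k (zetaOf M K) = zetaOf (d * M) L ^ d) (τ : L →+* ℂ) :
    expOf M K (τ.comp k) = ZMod.castHom (dvd_mul_left M d) (ZMod M) (expOf (d * M) L τ) := by
  have h : (τ.comp k) (zetaOf M K) = rootζ M ^ (ZMod.castHom (dvd_mul_left M d) (ZMod M) (expOf (d * M) L τ)).val := by
    rw [RingHom.comp_apply, hk, map_pow, expOf_spec (d * M) L τ, ← pow_mul, mul_comm (expOf (d * M) L τ).val d, pow_mul,
      rootζ_level_mul_pow M d, ZMod.castHom_apply, ZMod.cast_eq_val, ZMod.val_natCast]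
    exact pow_eq_pow_mod _ (rootζ_pow_level M)
  unfold expOf
  exact embExp_eq_of_apply_eq M _ h

omit [NeZero M] in
/-- The reduction modulo `M` of the exponent of `τ` is a unit residue. [cite: Washington1997, Thm. 2.5] -/
theorem coprime_castHom_expOf (τ : L →+* ℂ) :
    (ZMod.castHom (dvd_mul_left M d) (ZMod M) (expOf (d * M) L τ)).val.Coprime M :=
  coprime_val_castHom_level (coprime_expOf (d * M) L τ)

/-! ## §2 The CM type cut out by a pulled-back residue set is the INDUCED type -/

/-- **Induced type = pulled-back residue set.**  Let `S ⊂ (ℤ/M)ˣ` be a CM residue set and `S′ ⊂ (ℤ/dM)ˣ` its pull-back under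
reduction (`c ∈ S′ ↔ c̄ ∈ S` for units `c`).  If `k(ζ_M) = ζ_{dM}^d`, the CM type `Φ_{S′}` of `ℚ(ζ_{dM})` is the type INDUCED from
the CM type `Φ_S` of `ℚ(ζ_M)` along `k` (`τ ∈ Φ_{S′} ↔ τ ∘ k ∈ Φ_S`: "the `φᵢ` inducing the `ψⱼ` on `K`").
[cite: Shimura1998, §6.2 Theorem 3 (p. 42) and §8.2] [cite: KoblitzRohrlich1978, §1 (pp. 1183–1184)] -/
theorem inducedCMType_cmTypeOfResidues_eq {k : K →+* L} (hk : k (zetaOf M K) = zetaOf (d * M) L ^ d)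
    {S : Finset (ZMod M)} (hS : ∀ c : ZMod M, c.val.Coprime M → (c ∈ S ↔ -c ∉ S))
    {S' : Finset (ZMod (d * M))} (hS' : ∀ c : ZMod (d * M), c.val.Coprime (d * M) → (c ∈ S' ↔ -c ∉ S'))
    (hSS' : ∀ c : ZMod (d * M), c.val.Coprime (d * M) → (c ∈ S' ↔ ZMod.castHom (dvd_mul_left M d) (ZMod M) c ∈ S)) :
    inducedCMType k (cmTypeOfResidues (L := K) S hS) = cmTypeOfResidues (L := L) S' hS' := by
  refine Subtype.ext (Set.ext fun τ => ?_)
  rw [mem_inducedCMType_iff, mem_cmTypeOfResidues_iff, mem_cmTypeOfResidues_iff, expOf_comp_eq_castHom hk,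
    hSS' _ (coprime_expOf (d * M) L τ)]

end Level

end CyclotomicCMType

/-! ## §3 Fermat triples: `Φ_{H_{(da,db,dc)}}` of `ℚ(ζ_{dM})` is induced from `Φ_{H_{(a,b,c)}}` of `ℚ(ζ_M)` -/

namespace CyclotomicFermatCMType

section Induced

variable {M d : ℕ} [NeZero M] [NeZero (d * M)]
  {K : Type} [Field K] [NumberField K] [IsCyclotomicExtension {M} ℚ K]
  {L : Type} [Field L] [NumberField L] [IsCyclotomicExtension {d * M} ℚ L]

/-- **`H_{(da,db,dc)}` modulo `dM` is a CM residue set as soon as `H_{(a,b,c)}` modulo `M` is one** (the pull-back of a set of coset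
representatives of `{±1}` in `(ℤ/Mℤ)*` is a set of coset representatives of `{±1}` in `(ℤ/dMℤ)*`).
[cite: KoblitzRohrlich1978, §1 (pp. 1183–1184)] -/
theorem isCMResidueSet_fermatCMType_level_mul (a b c : ℕ)
    (hS : IsCMResidueSet M (fermatCMType M (a : ZMod M) (b : ZMod M) (c : ZMod M))) :
    IsCMResidueSet (d * M)
      (fermatCMType (d * M) ((d * a : ℕ) : ZMod (d * M)) ((d * b : ℕ) : ZMod (d * M)) ((d * c : ℕ) : ZMod (d * M))) := by
  refine ⟨fun x hx => (coprime_iff_mem_unitResidues _ x).1 ((mem_fermatCMType_level_mul_iff (CyclotomicCMType.pos_of_neZero_level M d) a b c x).1 hx).1,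
    fun x hx => ?_⟩
  have hxc : x.val.Coprime (d * M) := (coprime_iff_mem_unitResidues _ x).2 hx
  have hu : ZMod.castHom (dvd_mul_left M d) (ZMod M) x ∈ unitResidues M :=
    (coprime_iff_mem_unitResidues M _).1 (CyclotomicCMType.coprime_val_castHom_level hxc)
  rw [mem_fermatCMType_level_mul_iff (CyclotomicCMType.pos_of_neZero_level M d), mem_fermatCMType_level_mul_iff (CyclotomicCMType.pos_of_neZero_level M d), map_neg]
  rw [and_iff_right hxc, and_iff_right (CyclotomicCMType.coprime_val_neg_level hxc)]
  exact hS.2 _ hu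

/-- **THE LEVEL OF A TRIPLE AS AN INDUCED TYPE.**  For `N = dM` and `k : ℚ(ζ_M) → ℚ(ζ_N)` with `k(ζ_M) = ζ_N^d`, the CM type
`Φ_{H_{(da,db,dc)}}` of `ℚ(ζ_N)` cut out by the Fermat residue set of the triple `(da, db, dc)` modulo `N` (the tree's full-level reading)
is the type INDUCED along `k` from the CM type `Φ_{H_{(a,b,c)}}` of `ℚ(ζ_M)` — Koblitz–Rohrlich's own object: "let `M` be the integer
defined by `N/M = g.c.d.(N, r, s)` … `H_{r,s}` … the subset of `(ℤ/Mℤ)*` … Making the usual identification of `(ℤ/Mℤ)*` with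
`Gal(ℚ(e^{2πi/M})/ℚ)` … we define `L_{r,s}` as the lattice in `ℂ^{φ(M)/2}` … where `z` runs through the integers of `ℚ(e^{2πi/M})`".
[cite: KoblitzRohrlich1978, §1 (pp. 1183–1184)] [cite: Shimura1998, §6.2 Theorem 3 (p. 42)] -/
theorem inducedCMType_fermatCMType_level_mul {k : K →+* L} (hk : k (zetaOf M K) = zetaOf (d * M) L ^ d) (a b c : ℕ)
    (hS : IsCMResidueSet M (fermatCMType M (a : ZMod M) (b : ZMod M) (c : ZMod M)))
    (hS' : IsCMResidueSet (d * M)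
      (fermatCMType (d * M) ((d * a : ℕ) : ZMod (d * M)) ((d * b : ℕ) : ZMod (d * M)) ((d * c : ℕ) : ZMod (d * M)))) :
    inducedCMType k (cmTypeOfResidues (L := K) (fermatCMType M (a : ZMod M) (b : ZMod M) (c : ZMod M)) hS.cm) =
      cmTypeOfResidues (L := L)
        (fermatCMType (d * M) ((d * a : ℕ) : ZMod (d * M)) ((d * b : ℕ) : ZMod (d * M)) ((d * c : ℕ) : ZMod (d * M))) hS'.cm :=
  CyclotomicCMType.inducedCMType_cmTypeOfResidues_eq hk hS.cm hS'.cm fun x hx => by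
    rw [mem_fermatCMType_level_mul_iff (CyclotomicCMType.pos_of_neZero_level M d), and_iff_right hx]

end Induced

/-! ## §4 ON ABELIAN VARIETIES: `A_{(da,db,dc)} ∼ L_{(a,b,c)}^{φ(dM)/φ(M)}`, `dim L_{(a,b,c)} = φ(M)/2`; simple factors; non-simplicity -/

section Varieties

variable {M d : ℕ} [NeZero M] [NeZero (d * M)]
  {K : Type} [Field K] [NumberField K] [IsCyclotomicExtension {M} ℚ K]
  {L : Type} [Field L] [NumberField L] [IsCyclotomicExtension {d * M} ℚ L]
  {A : AbelianVariety ℂ} {ι : 𝓞 L →+* End A} {θ : L →+* Module.End ℂ (complexBetti A.X 1)}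

/-- `φ(M) > 0`. [folklore] -/
private theorem totient_pos_level (M : ℕ) [NeZero M] : 0 < M.totient := Nat.totient_pos.2 (Nat.pos_of_ne_zero (NeZero.ne M))

/-- **KOBLITZ–ROHRLICH §1 ON ABELIAN VARIETIES (the dimension bookkeeping `L_{r,s} ⊂ ℂ^{φ(M)/2}`), raw form.**  Let `N = dM`,
let `(a, b, c)` be a triple of naturals whose Fermat residue set `H_{(a,b,c)}` modulo `M` is a CM residue set, and let `(A, ι, θ)` be ANY
abelian variety realising the CM type `Φ_{H_{(da,db,dc)}}` of `L = ℚ(ζ_N)` on `H¹` (the full-level reading of the triple `(da, db, dc)`, as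
in every sibling file).  Then there are: an embedding `k : K = ℚ(ζ_M) → L` with `k(ζ_M) = ζ_N^d`; an abelian variety `(B, ι_B, θ_B)`
realising Koblitz–Rohrlich's own type `(ℚ(ζ_M); Φ_{H_{(a,b,c)}})` — their `L_{r,s,t}`, "the lattice in `ℂ^{φ(M)/2}` … `z` runs through
the integers of `ℚ(e^{2πi/M})`" — with `2 dim B = φ(M)`; a number `h` with `h·φ(M) = φ(N)`; a product `P = B^h` (a limit fan); and an
`𝓞_K`-equivariant ISOGENY `A → B^h` (Shimura §6.2 Thm. 3 for the induced type, tree `Shimura1998_Thm3_isogenousPower_holds`).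
[cite: KoblitzRohrlich1978, §1 (pp. 1183–1184)] [cite: Shimura1998, §6.2 Theorem 3 (pp. 42–44)] -/
theorem exists_isIsogeny_power_level_mul_raw [IsCMField K] [IsCMField L] (a b c : ℕ)
    (hS : IsCMResidueSet M (fermatCMType M (a : ZMod M) (b : ZMod M) (c : ZMod M)))
    (hS' : IsCMResidueSet (d * M)
      (fermatCMType (d * M) ((d * a : ℕ) : ZMod (d * M)) ((d * b : ℕ) : ZMod (d * M)) ((d * c : ℕ) : ZMod (d * M))))
    (hA : IsCMTypeRealisation (cmTypeOfResidues (L := L)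
      (fermatCMType (d * M) ((d * a : ℕ) : ZMod (d * M)) ((d * b : ℕ) : ZMod (d * M)) ((d * c : ℕ) : ZMod (d * M))) hS'.cm) A ι θ) :
    ∃ k : K →+* L, k (zetaOf M K) = zetaOf (d * M) L ^ d ∧
      ∃ (B : AbelianVariety ℂ) (ιB : 𝓞 K →+* End B) (θB : K →+* Module.End ℂ (complexBetti B.X 1)),
        IsCMTypeRealisation (cmTypeOfResidues (L := K) (fermatCMType M (a : ZMod M) (b : ZMod M) (c : ZMod M)) hS.cm) B ιB θB ∧
        2 * B.dim = M.totient ∧ 2 * A.dim = (d * M).totient ∧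
        ∃ (h : ℕ) (P : AbelianVariety ℂ) (π : Fin h → (P ⟶ B)), Nonempty (IsLimit (Fan.mk P π)) ∧
          h * M.totient = (d * M).totient ∧
          ∃ g : A ⟶ P, IsIsogeny g ∧
            ∀ (j : Fin h) (x : 𝓞 K), ι (RingOfIntegers.mapRingHom k x) ≫ (g ≫ π j) = (g ≫ π j) ≫ ιB x := by
  obtain ⟨k, hk⟩ := CyclotomicCMType.exists_ringHom_apply_zetaOf_eq_pow (M := M) (d := d) K L
  have hΦ := inducedCMType_fermatCMType_level_mul hk a b c hS hS'
  rw [← hΦ] at hA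
  obtain ⟨B, ιB, θB, hB, h, P, π, hP, g, hg, hequiv⟩ := Shimura1998_Thm3_isogenousPower_holds K L k _ A ι θ hA
  have hh : h * Module.finrank ℚ K = Module.finrank ℚ L := card_mul_finrank_eq_of_isIsogeny_fan hB hA hP hg
  rw [finrank_eq_totient M K, finrank_eq_totient (d * M) L] at hh
  refine ⟨k, hk, B, ιB, θB, hB, ?_, ?_, h, P, π, hP, hh, g, hg, hequiv⟩
  · rw [← finrank_eq_totient M K]
    exact (finrank_eq_two_mul_dim_of_isCMTypeRealisation hB).symm
  · rw [← finrank_eq_totient (d * M) L]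
    exact (finrank_eq_two_mul_dim_of_isCMTypeRealisation hA).symm

/-- **KOBLITZ–ROHRLICH §1 ON ABELIAN VARIETIES: `A_{(da,db,dc)} ∼ L_{(a,b,c)}^{φ(dM)/φ(M)}` with `dim L_{(a,b,c)} = φ(M)/2`.**  With the
data of `exists_isIsogeny_power_level_mul_raw`: the abelian variety realising the full-level type of the triple `(da, db, dc)` over
`ℚ(ζ_{dM})` (dimension `φ(dM)/2`) is isogenous to the power `B^{φ(dM)/φ(M)}` of an abelian variety `B` of dimension `φ(M)/2` realising
`(ℚ(ζ_M); Φ_{H_{(a,b,c)}})` — Koblitz–Rohrlich's `L_{r,s,t}` for the triple at its own level `M = N/g.c.d.` —, equivariantly for `𝓞_{ℚ(ζ_M)}`;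
in particular `φ(M) ∣ φ(dM)` and `dim A = (φ(dM)/φ(M)) · dim B`.
[cite: KoblitzRohrlich1978, §1 (pp. 1183–1184)] [cite: Shimura1998, §6.2 Theorem 3 (pp. 42–44)] -/
theorem exists_isIsogeny_power_level_mul [IsCMField K] [IsCMField L] (a b c : ℕ)
    (hS : IsCMResidueSet M (fermatCMType M (a : ZMod M) (b : ZMod M) (c : ZMod M)))
    (hS' : IsCMResidueSet (d * M)
      (fermatCMType (d * M) ((d * a : ℕ) : ZMod (d * M)) ((d * b : ℕ) : ZMod (d * M)) ((d * c : ℕ) : ZMod (d * M))))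
    (hA : IsCMTypeRealisation (cmTypeOfResidues (L := L)
      (fermatCMType (d * M) ((d * a : ℕ) : ZMod (d * M)) ((d * b : ℕ) : ZMod (d * M)) ((d * c : ℕ) : ZMod (d * M))) hS'.cm) A ι θ) :
    ∃ k : K →+* L, k (zetaOf M K) = zetaOf (d * M) L ^ d ∧
      ∃ (B : AbelianVariety ℂ) (ιB : 𝓞 K →+* End B) (θB : K →+* Module.End ℂ (complexBetti B.X 1)),
        IsCMTypeRealisation (cmTypeOfResidues (L := K) (fermatCMType M (a : ZMod M) (b : ZMod M) (c : ZMod M)) hS.cm) B ιB θB ∧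
        B.dim = M.totient / 2 ∧ A.dim = (d * M).totient / 2 ∧
        M.totient ∣ (d * M).totient ∧ A.dim = (d * M).totient / M.totient * B.dim ∧
        ∃ (P : AbelianVariety ℂ) (π : Fin ((d * M).totient / M.totient) → (P ⟶ B)), Nonempty (IsLimit (Fan.mk P π)) ∧
          ∃ g : A ⟶ P, IsIsogeny g ∧
            ∀ (j : Fin ((d * M).totient / M.totient)) (x : 𝓞 K),
              ι (RingOfIntegers.mapRingHom k x) ≫ (g ≫ π j) = (g ≫ π j) ≫ ιB x := by
  obtain ⟨k, hk, B, ιB, θB, hB, hBdim, hAdim, h, P, π, hP, hh, g, hg, hequiv⟩ :=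
    exists_isIsogeny_power_level_mul_raw (K := K) a b c hS hS' hA
  have hpos := totient_pos_level M
  have hq : h = (d * M).totient / M.totient := by rw [← hh, Nat.mul_div_cancel _ hpos]
  subst hq
  refine ⟨k, hk, B, ιB, θB, hB, by omega, by omega, Dvd.intro_left _ hh, ?_,
    P, π, hP, g, hg, hequiv⟩
  have e : 2 * A.dim = (d * M).totient / M.totient * (2 * B.dim) := by rw [hBdim, hh, hAdim]
  rw [Nat.mul_left_comm] at e
  exact Nat.eq_of_mul_eq_mul_left (by norm_num : 0 < 2) e

/-- **«`L_{r,s}` is simple if and only if `W_{r,s} = {1}`» for Koblitz–Rohrlich's own lattice** (the level-`M` variety `B` of the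
previous theorems): an abelian variety realising `(ℚ(ζ_M); Φ_{H_{(a,b,c)}})` is simple iff no unit `w ≠ 1` modulo `M` has
`wH_{(a,b,c)} = H_{(a,b,c)}` (the tree's `HasTrivialStabilizer`; Shimura–Taniyama, tree `isSimple_iff_isPrimitive` +
`isPrimitive_iff_hasTrivialStabilizer`). [cite: KoblitzRohrlich1978, §1 (p. 1184)] [cite: Shimura1998, §8.2 Prop. 26] -/
theorem isSimple_iff_hasTrivialStabilizer_fermatCMType {a b c : ZMod M} (hS : IsCMResidueSet M (fermatCMType M a b c))
    {B : AbelianVariety ℂ} {ιB : 𝓞 K →+* End B} {θB : K →+* Module.End ℂ (complexBetti B.X 1)}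
    (hB : IsCMTypeRealisation (cmTypeOfResidues (L := K) (fermatCMType M a b c) hS.cm) B ιB θB) :
    B.IsSimple ↔ HasTrivialStabilizer M (fermatCMType M a b c) := by
  obtain ⟨φ₀⟩ : Nonempty (K →+* ℂ) := inferInstance
  rw [isSimple_iff_isPrimitive hB φ₀, isPrimitive_iff_hasTrivialStabilizer M, residueSet_cmTypeOfResidues M hS]

/-- **THE SIMPLE FACTORS OF `A_{(da,db,dc)}`** («isogenous to a product of … isomorphic simple factors … These factors have complex
multiplication by an order of the fixed field of `W` and CM-type `H/W`», here in the case `W_{(a,b,c)} = {1}` modulo `M`, where the fixed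
field is `ℚ(ζ_M)` itself): if `H_{(a,b,c)}` has trivial stabiliser modulo `M`, every abelian variety realising the full-level type of
`(da, db, dc)` over `ℚ(ζ_{dM})` is isogenous to `B^{φ(dM)/φ(M)}` with `B` SIMPLE of dimension `φ(M)/2`, with complex multiplication by
`ℚ(ζ_M)` and CM type `Φ_{H_{(a,b,c)}}`. [cite: KoblitzRohrlich1978, §1 (p. 1184)] [cite: Shimura1998, §6.2 Theorem 3 and §8.2 Prop. 26] -/
theorem exists_isIsogeny_power_simple_level_mul [IsCMField K] [IsCMField L] (a b c : ℕ)
    (hS : IsCMResidueSet M (fermatCMType M (a : ZMod M) (b : ZMod M) (c : ZMod M)))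
    (hW : HasTrivialStabilizer M (fermatCMType M (a : ZMod M) (b : ZMod M) (c : ZMod M)))
    (hS' : IsCMResidueSet (d * M)
      (fermatCMType (d * M) ((d * a : ℕ) : ZMod (d * M)) ((d * b : ℕ) : ZMod (d * M)) ((d * c : ℕ) : ZMod (d * M))))
    (hA : IsCMTypeRealisation (cmTypeOfResidues (L := L)
      (fermatCMType (d * M) ((d * a : ℕ) : ZMod (d * M)) ((d * b : ℕ) : ZMod (d * M)) ((d * c : ℕ) : ZMod (d * M))) hS'.cm) A ι θ) :
    ∃ (B : AbelianVariety ℂ) (ιB : 𝓞 K →+* End B) (θB : K →+* Module.End ℂ (complexBetti B.X 1)),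
      IsCMTypeRealisation (cmTypeOfResidues (L := K) (fermatCMType M (a : ZMod M) (b : ZMod M) (c : ZMod M)) hS.cm) B ιB θB ∧
      B.IsSimple ∧ B.dim = M.totient / 2 ∧ A.dim = (d * M).totient / M.totient * B.dim ∧
      ∃ (P : AbelianVariety ℂ) (π : Fin ((d * M).totient / M.totient) → (P ⟶ B)), Nonempty (IsLimit (Fan.mk P π)) ∧
        ∃ g : A ⟶ P, IsIsogeny g := by
  obtain ⟨k, -, B, ιB, θB, hB, hBdim, -, -, hAB, P, π, hP, g, hg, -⟩ := exists_isIsogeny_power_level_mul (K := K) a b c hS hS' hA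
  exact ⟨B, ιB, θB, hB, (isSimple_iff_hasTrivialStabilizer_fermatCMType hS hB).2 hW, hBdim, hAB, P, π, hP, g, hg⟩

/-- **`A_{(da,db,dc)}` IS NOT SIMPLE when `φ(M) < φ(dM)`** (i.e. unless `d = 1`, or `d = 2` with `M` odd where `ℚ(ζ_{2M}) = ℚ(ζ_M)`): the
full-level reading of a non-primitive triple is a realisation of a type induced from the proper subfield `ℚ(ζ_M)` (Shimura §6.2 Thm. 3,
last clause, tree `not_isSimple_of_isCMTypeRealisation_inducedCMType`) — which is why Koblitz–Rohrlich read `(r, s, t)` at its own level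
`M = N/g.c.d.(N, r, s, t)`. [cite: KoblitzRohrlich1978, §1 (pp. 1183–1184)] [cite: Shimura1998, §6.2 Theorem 3 (p. 42)] -/
theorem not_isSimple_level_mul (hlt : M.totient < (d * M).totient) (a b c : ℕ)
    (hS : IsCMResidueSet M (fermatCMType M (a : ZMod M) (b : ZMod M) (c : ZMod M)))
    (hS' : IsCMResidueSet (d * M)
      (fermatCMType (d * M) ((d * a : ℕ) : ZMod (d * M)) ((d * b : ℕ) : ZMod (d * M)) ((d * c : ℕ) : ZMod (d * M))))
    (hA : IsCMTypeRealisation (cmTypeOfResidues (L := L)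
      (fermatCMType (d * M) ((d * a : ℕ) : ZMod (d * M)) ((d * b : ℕ) : ZMod (d * M)) ((d * c : ℕ) : ZMod (d * M))) hS'.cm) A ι θ) :
    ¬ A.IsSimple := by
  -- any model of `ℚ(ζ_M)` will do: Mathlib's `CyclotomicField M ℚ`
  haveI : IsCyclotomicExtension {M} ℚ (CyclotomicField M ℚ) := CyclotomicField.isCyclotomicExtension M ℚ
  obtain ⟨k, hk⟩ := CyclotomicCMType.exists_ringHom_apply_zetaOf_eq_pow (M := M) (d := d) (CyclotomicField M ℚ) L
  have hΦ := inducedCMType_fermatCMType_level_mul hk a b c hS hS'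
  rw [← hΦ] at hA
  exact not_isSimple_of_isCMTypeRealisation_inducedCMType k _ hA
    (by rwa [finrank_eq_totient M (CyclotomicField M ℚ), finrank_eq_totient (d * M) L])

end Varieties

/-! ## §5 THEOREM 4 «Furthermore, a lattice of type a)ₘ is isogenous to the product of two lattices of type e)ₘ₊₁» AS PRINTED -/

section Furthermore

variable {k : ℕ}
  {K : Type} [Field K] [NumberField K] [IsCyclotomicExtension {2 ^ k} ℚ K]
  {L : Type} [Field L] [NumberField L] [IsCyclotomicExtension {2 * 2 ^ k} ℚ L]
  {A : AbelianVariety ℂ} {ι : 𝓞 L →+* End A} {θ : L →+* Module.End ℂ (complexBetti A.X 1)}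

/-- A natural number strictly between `0` and the modulus is a non-zero residue. [folklore] -/
private theorem natCast_ne_zero_of_pos_of_lt_level {m x : ℕ} (h0 : 0 < x) (hlt : x < m) : ((x : ℕ) : ZMod m) ≠ 0 := by
  rw [Ne, ZMod.natCast_eq_zero_iff]
  exact fun h => absurd (Nat.le_of_dvd h0 h) (by omega)

/-- `H_{(1, 2ᵏ − 2, 2ᵏ + 1)} = H_{(2·1, 2·2ᵏ⁻¹, 2·(2ᵏ⁻¹ − 1))}` modulo `N = 2·2ᵏ` (`k ≥ 2`): the sibling's `fermatCMType_twoPow_furthermore_eq`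
(level `2ⁿ`, `n = k + 1`) with the level spelled `2·2ᵏ` and e)₁'s entries spelled as doubles. [cite: KoblitzRohrlich1978, Theorem 4 (p. 1186)] -/
private theorem furthermore_eq_level_two_mul (N : ℕ) [NeZero N] (hN : N = 2 ^ (k + 1)) (hk : 2 ≤ k) :
    fermatCMType N 1 ((2 ^ k - 2 : ℕ) : ZMod N) ((2 ^ k + 1 : ℕ) : ZMod N) =
      fermatCMType N ((2 * 1 : ℕ) : ZMod N) ((2 * 2 ^ (k - 1) : ℕ) : ZMod N) ((2 * (2 ^ (k - 1) - 1) : ℕ) : ZMod N) := by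
  subst hN
  have h := fermatCMType_twoPow_furthermore_eq (n := k + 1) (by omega)
  have e1 : k + 1 - 1 = k := by omega
  have e2 : 2 * 2 ^ (k - 1) = 2 ^ k := by
    obtain ⟨j, rfl⟩ : ∃ j, k = j + 1 := ⟨k - 1, by omega⟩
    rw [Nat.add_sub_cancel, pow_succ, mul_comm]
  have e3 : 2 * (2 ^ (k - 1) - 1) = 2 ^ k - 2 := by omega
  rw [e1] at h
  rw [e2, e3, mul_one, Nat.cast_ofNat]
  exact h

/-- **THEOREM 4, «Furthermore», AS PRINTED, ON ABELIAN VARIETIES** («a lattice of type a)ₘ is isogenous to the product of two lattices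
of type e)ₘ₊₁»; in Koblitz–Rohrlich's own level convention the type-a)ₘ lattice at `N = 2ⁿ` IS the type-a)₀ lattice at `2^{n−m}`, so the
statement is this one for every `n − m = k + 1 ≥ 3`).  Let `k ≥ 2`, `N = 2·2ᵏ`, and let `(A, ι, θ)` be ANY abelian variety realising the CM
type `Φ_{H_{(1, 2ᵏ − 2, 2ᵏ + 1)}}` of `ℚ(ζ_N)` — the a)₀ triple `(2⁰, 2ⁿ⁻¹ − 2¹, 2ⁿ⁻¹ + 2⁰)`, `n = k + 1` (dimension `2ᵏ⁻¹`).  Then there are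
an embedding `κ : ℚ(ζ_{2ᵏ}) → ℚ(ζ_N)` (`ζ_{2ᵏ} ↦ ζ_N²`), an abelian variety `(B, ι_B, θ_B)` realising the e)₀ type
`(ℚ(ζ_{2ᵏ}); Φ_{H_{(1, 2ᵏ⁻¹, 2ᵏ⁻¹ − 1)}})` — the type-e)₁ lattice of level `N`, `(2¹, 2ⁿ⁻¹, 2ⁿ⁻¹ − 2¹) = 2·(1, 2ᵏ⁻¹, 2ᵏ⁻¹ − 1)`, at its own
level `2ᵏ` (dimension `2ᵏ⁻²`) —, a product `P = B × B` (a limit fan on `Fin 2`) and an `𝓞_{ℚ(ζ_{2ᵏ})}`-equivariant ISOGENY `A → B × B`.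
Ingredients: the sibling's `H_{a)₀} = H_{e)₁}` (`fermatCMType_twoPow_furthermore_eq`), §3 (`Φ_{H_{e)₁}}` is induced from
`Φ_{H_{e)₀}}` of `ℚ(ζ_{2ᵏ})`), Shimura §6.2 Thm. 3, and `φ(2ᵏ⁺¹)/φ(2ᵏ) = 2`.
[cite: KoblitzRohrlich1978, Theorem 4 (p. 1186)] [cite: Shimura1998, §6.2 Theorem 3 (pp. 42–44)] -/
theorem exists_isIsogeny_prod_two_twoPow_furthermore (hk : 2 ≤ k)
    (hSa : IsCMResidueSet (2 * 2 ^ k)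
      (fermatCMType (2 * 2 ^ k) 1 ((2 ^ k - 2 : ℕ) : ZMod (2 * 2 ^ k)) ((2 ^ k + 1 : ℕ) : ZMod (2 * 2 ^ k))))
    (hSe : IsCMResidueSet (2 ^ k)
      (fermatCMType (2 ^ k) ((1 : ℕ) : ZMod (2 ^ k)) ((2 ^ (k - 1) : ℕ) : ZMod (2 ^ k)) ((2 ^ (k - 1) - 1 : ℕ) : ZMod (2 ^ k))))
    (hA : IsCMTypeRealisation (cmTypeOfResidues (L := L)
      (fermatCMType (2 * 2 ^ k) 1 ((2 ^ k - 2 : ℕ) : ZMod (2 * 2 ^ k)) ((2 ^ k + 1 : ℕ) : ZMod (2 * 2 ^ k))) hSa.cm) A ι θ) :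
    ∃ κ : K →+* L, κ (zetaOf (2 ^ k) K) = zetaOf (2 * 2 ^ k) L ^ 2 ∧
      ∃ (B : AbelianVariety ℂ) (ιB : 𝓞 K →+* End B) (θB : K →+* Module.End ℂ (complexBetti B.X 1)),
        IsCMTypeRealisation (cmTypeOfResidues (L := K)
          (fermatCMType (2 ^ k) ((1 : ℕ) : ZMod (2 ^ k)) ((2 ^ (k - 1) : ℕ) : ZMod (2 ^ k)) ((2 ^ (k - 1) - 1 : ℕ) : ZMod (2 ^ k)))
            hSe.cm) B ιB θB ∧
        2 * B.dim = 2 ^ (k - 1) ∧ A.dim = 2 ^ (k - 1) ∧ A.dim = 2 * B.dim ∧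
        ∃ (P : AbelianVariety ℂ) (π : Fin 2 → (P ⟶ B)), Nonempty (IsLimit (Fan.mk P π)) ∧
          ∃ g : A ⟶ P, IsIsogeny g ∧
            ∀ (j : Fin 2) (x : 𝓞 K), ι (RingOfIntegers.mapRingHom κ x) ≫ (g ≫ π j) = (g ≫ π j) ≫ ιB x := by
  have hk0 : k ≠ 0 := by omega
  have h4 : 4 ≤ 2 ^ k := by
    calc (4 : ℕ) = 2 ^ 2 := by norm_num
      _ ≤ 2 ^ k := Nat.pow_le_pow_right (by norm_num) hk
  haveI : IsCMField K := IsCyclotomicExtension.Rat.isCMField K (S := {2 ^ k}) ⟨2 ^ k, rfl, by omega⟩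
  haveI : IsCMField L := IsCyclotomicExtension.Rat.isCMField L (S := {2 * 2 ^ k}) ⟨2 * 2 ^ k, rfl, by omega⟩
  -- `H_{a)₀} = H_{2·e)₀}` at level `2·2ᵏ`, hence the same CM type
  have hEq := furthermore_eq_level_two_mul (k := k) (2 * 2 ^ k) (by rw [pow_succ, mul_comm]) hk
  have hS' : IsCMResidueSet (2 * 2 ^ k) (fermatCMType (2 * 2 ^ k) ((2 * 1 : ℕ) : ZMod (2 * 2 ^ k))
      ((2 * 2 ^ (k - 1) : ℕ) : ZMod (2 * 2 ^ k)) ((2 * (2 ^ (k - 1) - 1) : ℕ) : ZMod (2 * 2 ^ k))) :=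
    isCMResidueSet_fermatCMType_level_mul 1 (2 ^ (k - 1)) (2 ^ (k - 1) - 1) hSe
  have hA' : IsCMTypeRealisation (cmTypeOfResidues (L := L) (fermatCMType (2 * 2 ^ k) ((2 * 1 : ℕ) : ZMod (2 * 2 ^ k))
      ((2 * 2 ^ (k - 1) : ℕ) : ZMod (2 * 2 ^ k)) ((2 * (2 ^ (k - 1) - 1) : ℕ) : ZMod (2 * 2 ^ k))) hS'.cm) A ι θ := by
    have e : cmTypeOfResidues (L := L) (fermatCMType (2 * 2 ^ k) 1 ((2 ^ k - 2 : ℕ) : ZMod (2 * 2 ^ k))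
        ((2 ^ k + 1 : ℕ) : ZMod (2 * 2 ^ k))) hSa.cm = cmTypeOfResidues (L := L) (fermatCMType (2 * 2 ^ k)
        ((2 * 1 : ℕ) : ZMod (2 * 2 ^ k)) ((2 * 2 ^ (k - 1) : ℕ) : ZMod (2 * 2 ^ k)) ((2 * (2 ^ (k - 1) - 1) : ℕ) : ZMod (2 * 2 ^ k)))
        hS'.cm := by
      refine Subtype.ext (Set.ext fun τ => ?_)
      rw [mem_cmTypeOfResidues_iff, mem_cmTypeOfResidues_iff, hEq]
    rw [e] at hA
    exact hA
  obtain ⟨κ, hκ, B, ιB, θB, hB, hBdim, hAdim, h, P, π, hP, hh, g, hg, hequiv⟩ :=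
    exists_isIsogeny_power_level_mul_raw (K := K) 1 (2 ^ (k - 1)) (2 ^ (k - 1) - 1) hSe hS' hA'
  -- `φ(2ᵏ) = 2ᵏ⁻¹`, `φ(2·2ᵏ) = 2ᵏ`, so `h = 2`
  have hφK : (2 ^ k).totient = 2 ^ (k - 1) := by
    rw [Nat.totient_prime_pow Nat.prime_two (Nat.pos_of_ne_zero hk0)]; norm_num
  have hφL : (2 * 2 ^ k).totient = 2 ^ k := by
    rw [show 2 * 2 ^ k = 2 ^ (k + 1) by rw [pow_succ, mul_comm], Nat.totient_prime_pow Nat.prime_two (Nat.succ_pos k)]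
    norm_num
  have h2k : 2 ^ k = 2 * 2 ^ (k - 1) := by
    obtain ⟨j, rfl⟩ : ∃ j, k = j + 1 := ⟨k - 1, by omega⟩
    rw [Nat.add_sub_cancel, pow_succ, mul_comm]
  rw [hφK, hφL, h2k] at hh
  have hpos : 0 < 2 ^ (k - 1) := Nat.pos_of_ne_zero (pow_ne_zero _ two_ne_zero)
  have h2 : h = 2 := Nat.eq_of_mul_eq_mul_right hpos hh
  subst h2
  rw [hφK] at hBdim
  rw [hφL, h2k] at hAdim
  refine ⟨κ, hκ, B, ιB, θB, hB, hBdim, by omega, by omega, P, π, hP, g, hg, hequiv⟩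

/-- **«lattices of type e)»: both triples of the pair e) give the same factor.**  At level `2ᵏ` (`k ≥ 2`) the e)₀ triples
`(1, 2ᵏ⁻¹, 2ᵏ⁻¹ − 1)` and `(1, 1, 2ᵏ − 2)` cut out THE SAME CM type of `ℚ(ζ_{2ᵏ})` (the sibling's `fermatCMType_twoPow_e_eq`, Theorem 4 e)
at `m = 0`), so the factor `B` of `exists_isIsogeny_prod_two_twoPow_furthermore` is equally "a lattice of type" `(1, 1, 2ᵏ − 2)`: every
realisation of one type is a realisation of the other. [cite: KoblitzRohrlich1978, Theorem 4 e) (p. 1186)] -/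
theorem cmTypeOfResidues_twoPow_e_eq (hk : 2 ≤ k)
    (hSe : IsCMResidueSet (2 ^ k)
      (fermatCMType (2 ^ k) ((1 : ℕ) : ZMod (2 ^ k)) ((2 ^ (k - 1) : ℕ) : ZMod (2 ^ k)) ((2 ^ (k - 1) - 1 : ℕ) : ZMod (2 ^ k))))
    (hSe' : IsCMResidueSet (2 ^ k) (fermatCMType (2 ^ k) 1 1 ((2 ^ k - 2 : ℕ) : ZMod (2 ^ k)))) :
    cmTypeOfResidues (L := K)
        (fermatCMType (2 ^ k) ((1 : ℕ) : ZMod (2 ^ k)) ((2 ^ (k - 1) : ℕ) : ZMod (2 ^ k)) ((2 ^ (k - 1) - 1 : ℕ) : ZMod (2 ^ k))) hSe.cm =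
      cmTypeOfResidues (L := K) (fermatCMType (2 ^ k) 1 1 ((2 ^ k - 2 : ℕ) : ZMod (2 ^ k))) hSe'.cm := by
  have hEq := fermatCMType_twoPow_e_eq (n := k) hk
  rw [← Nat.cast_one (R := ZMod (2 ^ k))] at hEq
  refine Subtype.ext (Set.ext fun τ => ?_)
  rw [mem_cmTypeOfResidues_iff, mem_cmTypeOfResidues_iff, ← Nat.cast_one (R := ZMod (2 ^ k)), hEq]

/-- The two residue-set hypotheses of `exists_isIsogeny_prod_two_twoPow_furthermore` HOLD (both triples are admissible: non-zero entries
summing to `0`), and abelian varieties of the a)₀ type exist (Shimura §6.2 Thm. 3) — NON-VACUITY of the «Furthermore» statement: for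
every `k ≥ 2` there are an abelian variety `A` of type a)₀ of `ℚ(ζ_{2ᵏ⁺¹})` (dimension `2ᵏ⁻¹`), an abelian variety `B` of type e)₀ of
`ℚ(ζ_{2ᵏ})` (dimension `2ᵏ⁻²` doubled `= 2ᵏ⁻¹`), and an isogeny `A → B × B`. [cite: KoblitzRohrlich1978, Theorem 4 (p. 1186)]
[cite: Shimura1998, §6.2 Theorem 3 (pp. 41–44)] -/
theorem exists_realisation_isIsogeny_prod_two_twoPow_furthermore (hk : 2 ≤ k) :
    ∃ (hSa : IsCMResidueSet (2 * 2 ^ k)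
        (fermatCMType (2 * 2 ^ k) 1 ((2 ^ k - 2 : ℕ) : ZMod (2 * 2 ^ k)) ((2 ^ k + 1 : ℕ) : ZMod (2 * 2 ^ k))))
      (hSe : IsCMResidueSet (2 ^ k)
        (fermatCMType (2 ^ k) ((1 : ℕ) : ZMod (2 ^ k)) ((2 ^ (k - 1) : ℕ) : ZMod (2 ^ k)) ((2 ^ (k - 1) - 1 : ℕ) : ZMod (2 ^ k))))
      (A : AbelianVariety ℂ) (ι : 𝓞 L →+* End A) (θ : L →+* Module.End ℂ (complexBetti A.X 1))
      (B : AbelianVariety ℂ) (ιB : 𝓞 K →+* End B) (θB : K →+* Module.End ℂ (complexBetti B.X 1)),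
      IsCMTypeRealisation (cmTypeOfResidues (L := L)
        (fermatCMType (2 * 2 ^ k) 1 ((2 ^ k - 2 : ℕ) : ZMod (2 * 2 ^ k)) ((2 ^ k + 1 : ℕ) : ZMod (2 * 2 ^ k))) hSa.cm) A ι θ ∧
      IsCMTypeRealisation (cmTypeOfResidues (L := K)
        (fermatCMType (2 ^ k) ((1 : ℕ) : ZMod (2 ^ k)) ((2 ^ (k - 1) : ℕ) : ZMod (2 ^ k)) ((2 ^ (k - 1) - 1 : ℕ) : ZMod (2 ^ k)))
          hSe.cm) B ιB θB ∧
      A.dim = 2 ^ (k - 1) ∧ A.dim = 2 * B.dim ∧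
      ∃ (P : AbelianVariety ℂ) (π : Fin 2 → (P ⟶ B)), Nonempty (IsLimit (Fan.mk P π)) ∧ ∃ g : A ⟶ P, IsIsogeny g := by
  have hk0 : k ≠ 0 := by omega
  haveI : Fact (1 < 2 ^ k) := ⟨Nat.one_lt_pow hk0 (by norm_num)⟩
  have h4 : 4 ≤ 2 ^ k := by
    calc (4 : ℕ) = 2 ^ 2 := by norm_num
      _ ≤ 2 ^ k := Nat.pow_le_pow_right (by norm_num) hk
  have h2k : 2 ^ k = 2 * 2 ^ (k - 1) := by
    obtain ⟨j, rfl⟩ : ∃ j, k = j + 1 := ⟨k - 1, by omega⟩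
    rw [Nat.add_sub_cancel, pow_succ, mul_comm]
  -- the e)₀ triple modulo `2ᵏ` is admissible
  have hSe : IsCMResidueSet (2 ^ k)
      (fermatCMType (2 ^ k) ((1 : ℕ) : ZMod (2 ^ k)) ((2 ^ (k - 1) : ℕ) : ZMod (2 ^ k)) ((2 ^ (k - 1) - 1 : ℕ) : ZMod (2 ^ k))) := by
    refine isCMResidueSet_fermatCMType_of_ne_zero ?_ ?_ ?_ ?_
    · rw [Nat.cast_one]; exact one_ne_zero
    · exact natCast_ne_zero_of_pos_of_lt_level (by omega) (by omega)
    · exact natCast_ne_zero_of_pos_of_lt_level (by omega) (by omega)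
    · rw [← Nat.cast_add, ← Nat.cast_add, ZMod.natCast_eq_zero_iff]
      exact ⟨1, by omega⟩
  -- the a)₀ triple modulo `2·2ᵏ` is admissible
  haveI : Fact (1 < 2 * 2 ^ k) := ⟨by omega⟩
  haveI : IsCMField L := IsCyclotomicExtension.Rat.isCMField L (S := {2 * 2 ^ k}) ⟨2 * 2 ^ k, rfl, by omega⟩
  have hSa : IsCMResidueSet (2 * 2 ^ k)
      (fermatCMType (2 * 2 ^ k) 1 ((2 ^ k - 2 : ℕ) : ZMod (2 * 2 ^ k)) ((2 ^ k + 1 : ℕ) : ZMod (2 * 2 ^ k))) := by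
    refine isCMResidueSet_fermatCMType_of_ne_zero one_ne_zero ?_ ?_ ?_
    · exact natCast_ne_zero_of_pos_of_lt_level (by omega) (by omega)
    · exact natCast_ne_zero_of_pos_of_lt_level (by omega) (by omega)
    · rw [← Nat.cast_one, ← Nat.cast_add, ← Nat.cast_add, ZMod.natCast_eq_zero_iff]
      exact ⟨1, by omega⟩
  obtain ⟨A, ι, θ, hA⟩ := exists_isCMTypeRealisation (cmTypeOfResidues (L := L)
    (fermatCMType (2 * 2 ^ k) 1 ((2 ^ k - 2 : ℕ) : ZMod (2 * 2 ^ k)) ((2 ^ k + 1 : ℕ) : ZMod (2 * 2 ^ k))) hSa.cm)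
  obtain ⟨κ, -, B, ιB, θB, hB, -, hAdim, hAB, P, π, hP, g, hg, -⟩ :=
    exists_isIsogeny_prod_two_twoPow_furthermore (K := K) hk hSa hSe hA
  exact ⟨hSa, hSe, A, ι, θ, B, ιB, θB, hA, hB, hAdim, hAB, P, π, hP, g, hg⟩

end Furthermore

end CyclotomicFermatCMType

end Literature.AlgebraicGeometry.ComplexMultiplication

end
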